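import Literature.NumberTheory.EllipticCurves.ZpExtensionEisensteinSelmerStructure
import Literature.NumberTheory.EllipticCurves.IwasawaSelmerSupersingularLocalProofs
import Literature.NumberTheory.EllipticCurves.HeegnerModuleIndex
import HarnessLib

/-!
# The ordinary filtration `Fil_v E[p^k] = E[p^k] ∩ E₁(K̄_v)` of the torsion tower of an elliptic curve at a
# finite place: the `E`-instance of `ZpExtension.OrdinaryFiltration` (definitions with bodies + unfolding lemmas;
# no named fact, no instance, no notation)

Topic `NumberTheory/EllipticCurves` (D1 road of cell `pub/bsd-print-x9`; companion of
`ZpExtensionEisensteinSelmerStructure`, which defines Howard's Selmer structure `F_𝔮` on `T_𝔮` from an abstract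
ordinary datum `OrdinaryFiltration ρ t v` at the places `v ∣ p`).

Howard [Howard 2004, §3.1 (arXiv 1202.6340 p. 15, L56–58) and Def. 3.2.5]: «If `v` is a prime of `K` above `p`, we
define `Fil_v T` to be the kernel of the reduction map `T_p(E) → T_p(Ẽ)` where `Ẽ` is the reduction of `E` at `v`»;
Greenberg [LNM 1716, §2]: under good (ordinary) reduction the kernel of reduction on `E(K̄_v)` is the group
`𝓕(𝔪̄)` of the formal group. Level by level this is `Fil_v E[p^k] = E[p^k] ∩ E₁(K̄_v)`: the `p^k`-torsion points of
`E(K̄)` whose image in `E(K̄_v)` under the chosen embedding `K̄ → K̄_v` (`closureEmb`, `pointsMapOfEmb`) lies in the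
kernel of reduction `E₁(K̄_v)` — the tree's `WeierstrassCurve.localKernelOfReduction v` (file
`IwasawaSelmerSupersingularLocalProofs`: the points whose transport to the minimal model at `v` reduce to `Õ` modulo
the maximal ideal of the valuation ring of the spectral valuation of `K̄_v`; Silverman AEC VII.2).

* `WeierstrassCurve.torsionFilAt W v n : Submodule ℤ (geomTorsion W n)` — `E[n] ∩ E₁(K̄_v)`, with
  `mem_torsionFilAt_iff`;
* `WeierstrassCurve.smul_mem_torsionFilAt` — it is stable under the decomposition group `Γ_{K_v}` acting through
  `absGaloisRestrict K K_v` (`E₁(K̄_v)` is `Γ_{K_v}`-stable, `smul_mem_localKernelOfReduction_iff`, and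
  `pointsMapOfEmb` is equivariant, `pointsMapOfEmb_smul`); `zsmul_mem_torsionFilAt`-type closure is automatic
  (a submodule);
* **`WeierstrassCurve.ordinaryFiltrationAt W v t ht : ZpExtension.OrdinaryFiltration (fun k ↦ W.torsionGaloisModule
  ((p : ℤ) ^ k)) t v`** — the datum consumed by `ZpExtension.eisensteinSelmerStructure` at `v ∣ p`, for any family
  of transition maps `t k : E[p^{k+1}] → E[p^k]` that ARE multiplication by `p` (`ht`, as in
  `LambdaAdicSelmerData.toEisensteinH1`): `fil k = Fil_v E[p^k]`, `Γ_{K_v}`-stable, and `p • Fil_v E[p^{k+1}] ⊆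
  Fil_v E[p^k]` (`E₁` is a subgroup).

Nothing is asserted: that `Fil_v E[p^k]` is cyclic of order `p^k` with unramified quotient `Ẽ[p^k]` (good ORDINARY
reduction), maximal isotropic for the Weil pairing (Howard H.4), etc., are theorems for other files. DEFINITIONS WITH
BODIES and unfolding lemmas only; no instance, no notation, no `sorry`. BSD is not proved by any of this.

References: [Howard2004HeegnerKolyvagin] B. Howard, Compositio Math. 140 (2004) — arXiv 1202.6340 §3.1 (p. 15,
L56–58), Def. 3.2.5; [GreenbergLNM1716] R. Greenberg, LNM 1716 (1999), §2 (pp. 82–83: `𝓕(𝔪̄)`, the ordinary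
condition); [SilvermanAEC2009] J. H. Silverman, AEC 2nd ed., VII.2 Prop. 2.1–2.2 (`E₁`, the kernel of reduction).
-/

noncomputable section

open scoped TensorProduct Topology ContRepresentation
open Field IsDedekindDomain NumberField

universe u

namespace WeierstrassCurve

open Literature.NumberTheory.EllipticCurves Literature.NumberTheory.GaloisRepresentations

variable {K : Type u} [Field K] [NumberField K] (W : WeierstrassCurve K) (v : HeightOneSpectrum (𝓞 K))

/-- **`Fil_v E[n] = E[n] ∩ E₁(K̄_v)`**: the `n`-torsion points of `E(K̄)` whose image in `E(K̄_v)` under the chosen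
embedding `K̄ → K̄_v` lies in the kernel of reduction `E₁(K̄_v)` (`localKernelOfReduction`), as a `ℤ`-submodule of
`E[n]` (the carrier of `torsionGaloisModule n`). For `v ∣ p` of good ordinary reduction and `n = p^k` this is
Howard's `Fil_v` at level `k` (the `p^k`-torsion of the formal group). [cite: Howard2004HeegnerKolyvagin, §3.1 (arXiv p. 15, L56–58: Fil_v T = ker (T_p(E) → T_p(Ẽ))) and Def. 3.2.5]
[cite: GreenbergLNM1716, §2 (𝓕(𝔪̄))] -/
def torsionFilAt (n : ℤ) : Submodule ℤ (geomTorsion W n) :=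
  AddSubgroup.toIntSubmodule
    (((W.localKernelOfReduction v).comap
      (pointsMapOfEmb W (closureEmb (K := K) (v.adicCompletion K)))).comap (geomTorsion W n).subtype)

/-- Membership in `Fil_v E[n]`: the image of the point in `E(K̄_v)` lies in `E₁(K̄_v)`.
[cite: Howard2004HeegnerKolyvagin, §3.1 (Fil_v)] -/
theorem mem_torsionFilAt_iff (n : ℤ) (P : geomTorsion W n) :
    P ∈ W.torsionFilAt v n ↔
      pointsMapOfEmb W (closureEmb (K := K) (v.adicCompletion K)) (P : geomPoints W) ∈
        W.localKernelOfReduction v :=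
  Iff.rfl

/-- **`Fil_v E[n]` is stable under the decomposition group**: for `σ ∈ Γ_{K_v}` acting on `E[n]` through
`absGaloisRestrict K K_v` (the local module `GaloisRep.toLocal v (torsionGaloisModule n)`), `σ • Fil_v ⊆ Fil_v` —
`E₁(K̄_v)` is `Γ_{K_v}`-stable (`|σ x|_v = |x|_v`) and the embedding of points is equivariant.
[cite: Howard2004HeegnerKolyvagin, §3.1 (Fil_v T_𝔮 is a G_{K_v}-submodule)] [cite: GreenbergLNM1716, §2] -/
theorem smul_mem_torsionFilAt (n : ℤ) (σ : absoluteGaloisGroup (v.adicCompletion K)) (P : geomTorsion W n)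
    (hP : P ∈ W.torsionFilAt v n) :
    GaloisRep.toLocal v (W.torsionGaloisModule n) σ P ∈ W.torsionFilAt v n := by
  rw [mem_torsionFilAt_iff] at hP ⊢
  rw [GaloisRep.toLocal_apply, torsionGaloisModule_apply_apply, AddSubgroup.torsionBy.coe_smul,
    ← resGal_eq_absGaloisRestrict, resGal_eq, pointsMapOfEmb_smul]
  exact (W.smul_mem_localKernelOfReduction_iff v σ _).2 hP

/-- `Fil_v` is compatible with multiplication by `p`: `p • Fil_v E[p^{k+1}] ⊆ Fil_v E[p^k]` (`E₁(K̄_v)` is a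
subgroup). [cite: SilvermanAEC2009, VII.2 Prop. 2.1–2.2 (E₁ is a subgroup)] -/
theorem geomTorsionReduce_mem_torsionFilAt (p k : ℕ) (P : geomTorsion W ((p : ℤ) ^ (k + 1)))
    (hP : P ∈ W.torsionFilAt v ((p : ℤ) ^ (k + 1))) :
    W.geomTorsionReduce p k P ∈ W.torsionFilAt v ((p : ℤ) ^ k) := by
  rw [mem_torsionFilAt_iff] at hP ⊢
  rw [coe_geomTorsionReduce, map_zsmul]
  exact AddSubgroup.zsmul_mem _ hP _

variable {p : ℕ}
  (t : ∀ k, (W.torsionGaloisModule ((p : ℤ) ^ (k + 1))).toContRepresentation →ⁱL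
    (W.torsionGaloisModule ((p : ℤ) ^ k)).toContRepresentation)
  (ht : ∀ k (P : geomTorsion W ((p : ℤ) ^ (k + 1))), t k P = W.geomTorsionReduce p k P)

/-- **The ordinary filtration of the torsion tower of `E` at a finite place `v`** (intended `v ∣ p` of good
ordinary reduction): the datum `ZpExtension.OrdinaryFiltration` with `fil k = Fil_v E[p^k] = E[p^k] ∩ E₁(K̄_v)`,
`Γ_{K_v}`-stable and compatible with the transitions `t k = (P ↦ p • P)` (`ht`). Feeding it to
`ZpExtension.eisensteinSelmerStructure` gives Howard's `F_𝔮` on `T_𝔮 = T_p E ⊗ Λ/(T^m + p)(ψ)` for the curve `E`.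
[cite: Howard2004HeegnerKolyvagin, Def. 3.2.5 (Fil_v 𝐓 = lim Ind Fil_v T) and §3.1 (Fil_v T_𝔮)] [cite: GreenbergLNM1716, §2] -/
def ordinaryFiltrationAt :
    ZpExtension.OrdinaryFiltration (fun k ↦ W.torsionGaloisModule ((p : ℤ) ^ k)) t v where
  fil k := W.torsionFilAt v ((p : ℤ) ^ k)
  smul_mem k σ P hP := W.smul_mem_torsionFilAt v _ σ P hP
  map_mem k P hP := by
    rw [ht k P]
    exact W.geomTorsionReduce_mem_torsionFilAt v p k P hP

/-- Unfolding `ordinaryFiltrationAt`: its `fil k` is `Fil_v E[p^k]`. [cite: Howard2004HeegnerKolyvagin, §3.1] -/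
@[simp]
theorem ordinaryFiltrationAt_fil (k : ℕ) : (W.ordinaryFiltrationAt v t ht).fil k = W.torsionFilAt v ((p : ℤ) ^ k) :=
  rfl

end WeierstrassCurve

end
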